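import Literature.Geometry.Kaehler.ComplexTorusLineBundleFactor
import HarnessLib

/-!
# Local theta functions of a holomorphic line bundle on a complex torus with respect to a factor of
# automorphy representing it (Lange 2023, §1.2.1 Prop. 1.2.3 / Exercise 1.2.3 (8), LOCAL form)

Layer `Literature/Geometry/Kaehler`, namespace `Literature.Geometry.Kaehler.ComplexTorus`.  PROOF FILE (theorems only;
no definition, no named fact).  Let `X = E/Φ(ℤ^ι)` be a complex torus with covering map `π = cover Φ : E → X`, let
`L` be a holomorphic line bundle on `X` in the tree's Čech presentation (`HolomorphicLineBundle κ E X`: cover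
`B_k = L.baseSet k`, transition functions `g_{kl} = L.coordChange k l`, sections transform as `t_l = g_{kl} t_k`)
and let `e` be a factor of automorphy REPRESENTING `L`, i.e. `L ⊗ L_{e⁻¹}` is holomorphically trivial on `X`
(`(L.tensor (factorLineBundle he.inv)).IsTrivialOn univ` — this is `picClass L = ⟦e⟧`, the tree's
`ComplexTorus.picClass_eq_toPic_iff`).  Then the bundle `L` is described on `E` by LOCAL THETA FUNCTIONS for `e`:
there are functions `G_k : E → ℂ`, one for each trivialising set `B_k` of `L`, holomorphic and nowhere zero on
`π⁻¹(B_k)`, satisfying the functional equation of `e`,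

  `G_k(v + Φ n) = e(n, v) · G_k(v)`,

and changing frame by the cocycle of `L`: `G_k = (g_{kl} ∘ π) · G_l` on `π⁻¹(B_k ∩ B_l)`.  This is the local
form of Lange's Prop. 1.2.3 («the sections of `L` … may be considered as holomorphic functions on `V` satisfying
`θ(λ + v) = f(λ, v) θ(v)`») = Exercise 1.2.3 (8) («`L` is the line bundle of the sheaf
`𝓛(U) = {ϑ : π⁻¹(U) → ℂ holomorphic, ϑ(v + λ) = f(λ, v) ϑ(v)}`»): the frame `σ_k` of `L` over `B_k` IS such a
`ϑ ∈ 𝓛(B_k)`, namely `G_k`.  Construction: a trivialising section `u` of `L ⊗ L_{e⁻¹}` has, for fixed `k`,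
coordinates `a ↦ u_{(k,a)}` forming a nowhere-zero section of `L_{e⁻¹}` over `B_k`; its lift to `π⁻¹(B_k)`
(the tree's `liftAux` recipe `v ↦ e⁻¹(n_a(v), s_a(π v)) · u_{(k,a)}(π v)`, independent of the chart `a` by the
cocycle relation (1.7)) is a local theta function for `e⁻¹`, and `G_k` is its inverse.

* `exists_localTheta_of_isTrivialOn_tensor_inv` — the statement.

Purpose (cell hodgecm-mathlib, D5 junction (J) «algebraic `e_N` = analytic `e_N`», step (G2): applied to
`L = 𝒪(E)^an = cartierDivisorLineBundle hφ E` on the uniformising torus of a complex abelian variety and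
`e = (0, χ_t)` the character of a dual point, it turns the algebraic Cartier data of `E` into holomorphic functions
on `V` with automorphy `χ_t`).

## References
* [Lange2023AbelianVarietiesComplex] H. Lange, *Abelian Varieties over the Complex Numbers* (2023), §1.2.1
  Prop. 1.2.2–1.2.3 (p. 21) and Exercise 1.2.3 (8).
* [VoisinHodgeI2002] C. Voisin, *Hodge Theory and Complex Algebraic Geometry I* (2002), §3.3.1 (cocycle
  presentation of line bundles), Thm. 4.49.
-/

noncomputable section

open scoped Manifold Topology
open Set Filter Function

namespace Literature.Geometry.Kaehler

namespace ComplexTorus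

variable {ι : Type*} {E : Type*} [NormedAddCommGroup E] [NormedSpace ℂ E] {Φ : (ι → ℝ) ≃L[ℝ] E}
  [Fintype ι] {κ : Type*} {e : (ι → ℤ) → E → ℂ}

/-- **Local theta functions of a line bundle with respect to a factor representing it** (Lange 2023, Prop. 1.2.3 /
Exercise 1.2.3 (8), local form).  If `L ⊗ L_{e⁻¹}` is holomorphically trivial on the torus `X = E/Φ(ℤ^ι)` (i.e.
`L ≅ L_e`), then there are `G_k : E → ℂ`, `k` ranging over the trivialising cover `B_k` of `L`, with:
(i) `G_k` holomorphic on `π⁻¹(B_k)`; (ii) `G_k ≠ 0` on `π⁻¹(B_k)`; (iii) the functional equation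
`G_k(v + Φ n) = e(n, v) G_k(v)` for all `n ∈ ℤ^ι`, `v ∈ E`; (iv) the frame change `G_k = (g_{kl} ∘ π) · G_l` on
`π⁻¹(B_k ∩ B_l)`, `g_{kl}` the transition functions of `L`.
[cite: Lange2023AbelianVarietiesComplex, §1.2.1 Prop. 1.2.3 (p. 21) and Exercise 1.2.3 (8)]
[cite: VoisinHodgeI2002, §3.3.1] -/
theorem exists_localTheta_of_isTrivialOn_tensor_inv (L : HolomorphicLineBundle κ E (ComplexTorus Φ))
    (he : IsFactor Φ e) (h : (L.tensor (factorLineBundle he.inv)).IsTrivialOn univ) :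
    ∃ G : κ → E → ℂ,
      (∀ k, DifferentiableOn ℂ (G k) (cover Φ ⁻¹' L.baseSet k)) ∧
      (∀ k v, cover Φ v ∈ L.baseSet k → G k v ≠ 0) ∧
      (∀ k (n : ι → ℤ) (v : E), G k (v + latticeVec Φ n) = e n v * G k v) ∧
      (∀ k l (v : E), cover Φ v ∈ L.baseSet k → cover Φ v ∈ L.baseSet l →
        G k v = L.coordChange k l (cover Φ v) * G l v) := by
  obtain ⟨u, hu, hu0, hug⟩ := h
  -- the transformation rules of the trivialising section `u` of `L ⊗ L_{e⁻¹}`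
  have hrule : ∀ (k l : κ) (a b : ι → ℝ) (x : ComplexTorus Φ), x ∈ L.baseSet k → x ∈ L.baseSet l →
      x ∈ (chart Φ a).source → x ∈ (chart Φ b).source →
      u (l, b) x = L.coordChange k l x * (e (transIndex Φ a b x) (chart Φ a x))⁻¹ * u (k, a) x := by
    intro k l a b x hk hl ha hb
    have := hug (k, a) (l, b) x ⟨⟨⟨hk, ha⟩, hl, hb⟩, mem_univ x⟩
    rw [this, HolomorphicLineBundle.tensor_coordChange, factorLineBundle_coordChange]
  have hune : ∀ (k : κ) (a : ι → ℝ) (x : ComplexTorus Φ), x ∈ L.baseSet k → x ∈ (chart Φ a).source →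
      u (k, a) x ≠ 0 := fun k a x hk ha ↦ hu0 (k, a) x ⟨⟨hk, ha⟩, mem_univ x⟩
  -- the local theta function read in the frame `a`
  let F : κ → (ι → ℝ) → E → ℂ := fun k a v ↦
    e (boxIndex Φ a v) (chart Φ a (cover Φ v)) * (u (k, a) (cover Φ v))⁻¹
  -- independence of the frame
  have hF : ∀ (k : κ) (a b : ι → ℝ) (v : E), cover Φ v ∈ L.baseSet k → cover Φ v ∈ (chart Φ a).source →
      cover Φ v ∈ (chart Φ b).source → F k a v = F k b v := by
    intro k a b v hk ha hb
    set x := cover Φ v with hxdef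
    have hchart := chart_eq_chart_add_latticeVec Φ a b hb
    have hidx : boxIndex Φ a v = boxIndex Φ b v + transIndex Φ a b x := by
      apply latticeVec_injective Φ
      have h1 := chart_cover_add_latticeVec Φ a v
      have h2 := chart_cover_add_latticeVec Φ b v
      rw [← hxdef] at h1 h2
      rw [hchart, add_assoc, ← latticeVec_add, add_comm (transIndex Φ a b x)] at h2
      exact add_left_cancel (h1.trans h2.symm)
    have hub : u (k, b) x = (e (transIndex Φ a b x) (chart Φ a x))⁻¹ * u (k, a) x := by
      rw [hrule k k a b x hk hk ha hb, L.coordChange_self k hk, one_mul]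
    have hea : e (transIndex Φ a b x) (chart Φ a x) ≠ 0 := he.ne_zero _ _
    simp only [F, ← hxdef]
    rw [hub, hchart, hidx, he.cocycle, mul_inv, inv_inv]
    ring
  -- the local theta functions, read in the preferred frame at `π v`
  let G : κ → E → ℂ := fun k v ↦ F k (corner Φ (cover Φ v)) v
  have hcorner : ∀ v : E, cover Φ v ∈ (chart Φ (corner Φ (cover Φ v))).source := fun v ↦ by
    rw [← chartAt_eq]; exact mem_chart_source E _
  have hGF : ∀ (k : κ) (a : ι → ℝ) (v : E), cover Φ v ∈ L.baseSet k → cover Φ v ∈ (chart Φ a).source →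
      G k v = F k a v := fun k a v hk ha ↦ hF k _ a v hk (hcorner v) ha
  refine ⟨G, fun k ↦ ?_, fun k v hk ↦ ?_, fun k n v ↦ ?_, fun k l v hk hl ↦ ?_⟩
  · -- (i) holomorphy on `π⁻¹(B_k)`: near `v₀` the frame and the box index are constant
    intro v₀ hv₀
    have hk₀ : cover Φ v₀ ∈ L.baseSet k := hv₀
    set a := corner Φ (cover Φ v₀) with hadef
    have ha : cover Φ v₀ ∈ (chart Φ a).source := hcorner v₀
    have hU : ∀ᶠ v in 𝓝 v₀, cover Φ v ∈ (chart Φ a).source ∧ cover Φ v ∈ L.baseSet k :=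
      (continuous_cover Φ).continuousAt.preimage_mem_nhds
        (((chart Φ a).open_source.inter (L.isOpen_baseSet k)).mem_nhds ⟨ha, hk₀⟩)
    have hev : G k =ᶠ[𝓝 v₀]
        fun v ↦ e (boxIndex Φ a v₀) (v - latticeVec Φ (boxIndex Φ a v₀)) * (u (k, a) (cover Φ v))⁻¹ := by
      filter_upwards [hU, eventually_boxIndex_eq Φ ha, eventuallyEq_chart_cover Φ ha] with v hv hn hc
      rw [hGF k a v hv.2 hv.1]
      simp only [F]
      rw [hn, hc]
    have hd : DifferentiableAt ℂ
        (fun v ↦ e (boxIndex Φ a v₀) (v - latticeVec Φ (boxIndex Φ a v₀)) * (u (k, a) (cover Φ v))⁻¹) v₀ := by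
      refine DifferentiableAt.mul ?_ ?_
      · exact ((he.differentiable _).comp (differentiable_id.sub_const _)) v₀
      · have hs : MDifferentiableAt 𝓘(ℂ, E) 𝓘(ℂ, ℂ) (u (k, a)) (cover Φ v₀) :=
          ((hu (k, a)).mono fun x hx ↦ ⟨hx, mem_univ x⟩).mdifferentiableAt
            (((L.isOpen_baseSet k).inter (chart Φ a).open_source).mem_nhds ⟨hk₀, ha⟩)
        have hcomp : DifferentiableAt ℂ (fun v ↦ u (k, a) (cover Φ v)) v₀ :=
          mdifferentiableAt_iff_differentiableAt.mp (hs.comp v₀ (mdifferentiable_cover Φ (𝕜 := ℂ) v₀))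
        exact hcomp.inv (hune k a _ hk₀ ha)
    exact (hd.congr_of_eventuallyEq hev).differentiableWithinAt
  · -- (ii) non-vanishing
    rw [hGF k _ v hk (hcorner v)]
    exact mul_ne_zero (he.ne_zero _ _) (inv_ne_zero (hune k _ _ hk (hcorner v)))
  · -- (iii) the functional equation of `e`
    simp only [G, F, cover_add_latticeVec, boxIndex_add_latticeVec]
    set a := corner Φ (cover Φ v)
    rw [he.cocycle' n (boxIndex Φ a v), chart_cover_add_latticeVec, mul_assoc]
  · -- (iv) frame change along the cocycle of `L`
    set a := corner Φ (cover Φ v) with hadef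
    have ha : cover Φ v ∈ (chart Φ a).source := hcorner v
    rw [hGF k a v hk ha, hGF l a v hl ha]
    simp only [F]
    rw [hrule k l a a (cover Φ v) hk hl ha ha, transIndex_self Φ ha, he.map_zero]
    have hg : L.coordChange k l (cover Φ v) ≠ 0 := L.coordChange_ne_zero k l _ ⟨hk, hl⟩
    have hu' : u (k, a) (cover Φ v) ≠ 0 := hune k a _ hk ha
    field_simp

end ComplexTorus

end Literature.Geometry.Kaehler

end
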